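import Literature.Geometry.Symplectic.GromovR4StdModel
import Literature.Geometry.Kaehler.TranslationHomotopy
import Literature.Geometry.Kaehler.PoincareLemmaStarConvex
import Mathlib.Analysis.InnerProductSpace.PiL2
import Mathlib.Analysis.SpecialFunctions.SmoothTransition
import HarnessLib

/-!
# Compactly supported Poincaré lemma in degree two on `ℝ⁴` (helper for stub `stub_tameMoser`)

Helper file for stub `stub_tameMoser` of line `cross-cap-laurent` (crux `GromovRecognitionRelEnd`,
item stmt-SmoothPoincare4-11009): the compactly supported cohomology input `H²_c(ℝ⁴) = 0` of the
compactly supported Moser argument, for Mathlib forms `τ : ℝ⁴ → ℝ⁴ [⋀^Fin 2]→L[ℝ] F` and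
Mathlib's `extDeriv`:

* `exists_extDeriv_eq_hasCompactSupport` — **a closed `C^∞` `2`-form on `ℝ⁴` with support in a
  ball is `dβ` for a `C^∞` `1`-form `β` with compact support** (Bott–Tu (1982), §I.4, Poincaré
  lemma for compact supports, Cor. 4.7.1: `H²_c(ℝ⁴) = 0`).

Proof (integration along the fibre, Bott–Tu §I.4, in finite pieces so that only the tree's
homotopy operator of a translation `transOperator a`
(`Literature.Geometry.Kaehler.TranslationHomotopy`:
`d (P_a τ) + P_a (dτ) = τ(· + a) − τ`) is needed): with `T` large, `β⁺ = −P_{T e₀} τ` and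
`β⁻ = −P_{−T e₀} τ` are primitives of `τ` on the slab `|x₀| < T − r`, supported in half-cylinders
along `e₀`; `Q = β⁻ − β⁺` is closed there and supported in the cylinder `{|x₁|, |x₂|, |x₃| ≤ r}`;
`q± = −P_{±T e₁} Q` are primitives of `Q` on `{|x₀|, |x₁| < T − r}` which agree (their difference
has `d = 0` on a convex set and vanishes at `(r+1) e₂`, degree-`0` Poincaré lemma
`eq_of_extDeriv_eq_zero_of_starConvex`), so `q⁺` is supported in `{|x₁|, |x₂|, |x₃| ≤ r}`; then
`β⁺ + d(θ(x₀) q⁺)`, `θ = 1` for `x₀ ≤ −r − 1`, `θ = 0` for `x₀ ≥ −r − ½`, is a primitive of `τ`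
vanishing on the shell `2r + 1 < ‖x‖ < 2r + 3`, and a cut-off makes it global.

Everything is proved; no definition, no named fact.

References: R. Bott, L. W. Tu, *Differential Forms in Algebraic Topology* (1982), §I.4
(Poincaré lemma for compactly supported cohomology); D. McDuff, D. Salamon, *Introduction to
Symplectic Topology*, 3rd ed. (2017), §3.2 (where it is used in Moser's argument).
-/

noncomputable section

-- the prescribed namespace `Summit.<P>.<Sub>.…` duplicates `SmoothPoincare4` (P = Sub)
set_option linter.dupNamespace false

open scoped Manifold ContDiff Topology
open Set TopologicalSpace Literature.Geometry.Kaehler Literature.Geometry.Symplectic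

namespace Summit.SmoothPoincare4.SmoothPoincare4.Theorems.GromovRecognitionRelEnd.CrossCapLaurent

/-! ## Generic facts on `extDeriv` and the translation homotopy operator -/

section Generic

variable {E : Type*} [NormedAddCommGroup E] [NormedSpace ℝ E]
  {F : Type*} [NormedAddCommGroup F] [NormedSpace ℝ F] {k : ℕ}

/-- `d` of the zero form vanishes (pointwise, for a form vanishing near the point). [folklore] -/
theorem extDeriv_eq_zero_of_eventuallyEq_zero {f : E → E [⋀^Fin k]→L[ℝ] F} {x : E}
    (h : ∀ᶠ y in 𝓝 x, f y = 0) : extDeriv f x = 0 := by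
  have h' : f =ᶠ[𝓝 x] fun _ ↦ (0 : E [⋀^Fin k]→L[ℝ] F) := h
  rw [h'.extDeriv_eq]
  simp only [extDeriv, fderiv_fun_const, Pi.zero_apply,
    ← ContinuousAlternatingMap.alternatizeUncurryFinCLM_apply, map_zero]

/-- `d(-f) = -df` (no differentiability needed). [folklore] -/
theorem extDeriv_fun_neg (f : E → E [⋀^Fin k]→L[ℝ] F) (x : E) :
    extDeriv (fun y ↦ -f y) x = -extDeriv f x := by
  simp only [extDeriv, fderiv_fun_neg, ← ContinuousAlternatingMap.alternatizeUncurryFinCLM_apply,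
    map_neg]

/-- `d(f - g) = df - dg` for forms differentiable at the point. [folklore] -/
theorem extDeriv_fun_sub {f g : E → E [⋀^Fin k]→L[ℝ] F} {x : E} (hf : DifferentiableAt ℝ f x)
    (hg : DifferentiableAt ℝ g x) :
    extDeriv (fun y ↦ f y - g y) x = extDeriv f x - extDeriv g x := by
  simp only [sub_eq_add_neg]
  rw [extDeriv_fun_add (ω₂ := fun y ↦ -g y) hf hg.neg, extDeriv_fun_neg]

/-- The exterior derivative of a `C^∞` form is `C^∞`. [folklore] -/
theorem contDiff_extDeriv {f : E → E [⋀^Fin k]→L[ℝ] F} (hf : ContDiff ℝ ∞ f) :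
    ContDiff ℝ ∞ (extDeriv f) := by
  have h : extDeriv f = fun x ↦
      ContinuousAlternatingMap.alternatizeUncurryFinCLM ℝ E F (fderiv ℝ f x) := by
    funext x
    rw [ContinuousAlternatingMap.alternatizeUncurryFinCLM_apply, extDeriv]
  rw [h]
  exact (ContinuousAlternatingMap.alternatizeUncurryFinCLM ℝ E F).contDiff.comp
    (hf.fderiv_right (m := ∞) (by simp))

/-- A translation homotopy integral vanishes if the integrand vanishes along the segment.
[folklore] -/
theorem transOperator_eq_zero_of_forall (a : E) {β : E → E [⋀^Fin (k + 1)]→L[ℝ] F} {x : E}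
    (h : ∀ t ∈ Icc (0 : ℝ) 1, β (x + t • a) = 0) : transOperator a β x = 0 := by
  have h1 : transOperator a β x = ∫ t in (0 : ℝ)..1, (0 : E [⋀^Fin k]→L[ℝ] F) := by
    refine intervalIntegral.integral_congr fun t ht ↦ ?_
    rw [uIcc_of_le zero_le_one] at ht
    simp only [transIntegrand, h t ht, ContinuousAlternatingMap.curryLeft_zero]
    rfl
  rw [h1, intervalIntegral.integral_zero]

variable [FiniteDimensional ℝ E] [CompleteSpace F]

/-- **The shifted primitive.** For a `C^∞` form `τ` of positive degree,
`d(−P_a τ) x = τ x − τ (x + a) + P_a (dτ) x` (the tree's homotopy formula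
`extDeriv_transOperator_add`, rearranged). [folklore] -/
theorem extDeriv_neg_transOperator (a : E) {τ : E → E [⋀^Fin (k + 1)]→L[ℝ] F}
    (hτ : ContDiff ℝ ∞ τ) (x : E) :
    extDeriv (fun y ↦ -transOperator a τ y) x =
      τ x - τ (x + a) + transOperator a (extDeriv τ) x := by
  rw [extDeriv_fun_neg]
  have h := extDeriv_transOperator_add a hτ x
  rw [← eq_sub_iff_add_eq] at h
  rw [h]
  abel

end Generic

/-! ## Coordinates on `ℝ⁴` and the support of translation integrals -/

section Coordinates

variable {F : Type*} [NormedAddCommGroup F] [NormedSpace ℝ F] {k : ℕ}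
  {ι : Type*} [Fintype ι] [DecidableEq ι]

omit [Fintype ι] in
/-- The `i`-th coordinate of `x + t eᵢ` is `xᵢ + t`. [folklore] -/
theorem coord_add_smul_single_self (x : EuclideanSpace ℝ ι) (t : ℝ) (i : ι) :
    (x + t • EuclideanSpace.single i (1 : ℝ)) i = x i + t := by
  simp

omit [Fintype ι] in
/-- The other coordinates of `x + t eᵢ` are those of `x`. [folklore] -/
theorem coord_add_smul_single_of_ne (x : EuclideanSpace ℝ ι) (t : ℝ) {i j : ι} (h : j ≠ i) :
    (x + t • EuclideanSpace.single i (1 : ℝ)) j = x j := by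
  simp [h]

/-- A translation integral along `eᵢ` vanishes at `x` if the integrand vanishes on the
hyperplane `{y | y j = x j}` for some other coordinate `j ≠ i` (translation along `eᵢ` does not
change `y j`). [folklore] -/
theorem transOperator_single_eq_zero_of_ne
    {β : EuclideanSpace ℝ ι → EuclideanSpace ℝ ι [⋀^Fin (k + 1)]→L[ℝ] F} {x : EuclideanSpace ℝ ι}
    {i j : ι} (hj : j ≠ i) (h : ∀ y : EuclideanSpace ℝ ι, y j = x j → β y = 0) (c : ℝ) :
    transOperator (c • EuclideanSpace.single i (1 : ℝ)) β x = 0 := by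
  refine transOperator_eq_zero_of_forall _ fun t _ ↦ h _ ?_
  rw [smul_smul]
  exact coord_add_smul_single_of_ne x (t * c) hj

/-- A translation integral along `+eᵢ` vanishes at `x` if the integrand vanishes on the half-space
`{y | x i ≤ y i}`. [folklore] -/
theorem transOperator_single_eq_zero_of_le
    {β : EuclideanSpace ℝ ι → EuclideanSpace ℝ ι [⋀^Fin (k + 1)]→L[ℝ] F} {x : EuclideanSpace ℝ ι}
    {i : ι} {c : ℝ} (hc : 0 ≤ c) (h : ∀ y : EuclideanSpace ℝ ι, x i ≤ y i → β y = 0) :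
    transOperator (c • EuclideanSpace.single i (1 : ℝ)) β x = 0 := by
  refine transOperator_eq_zero_of_forall _ fun t ht ↦ h _ ?_
  rw [smul_smul, coord_add_smul_single_self]
  exact le_add_of_nonneg_right (mul_nonneg ht.1 hc)

/-- A translation integral along `−eᵢ` vanishes at `x` if the integrand vanishes on the half-space
`{y | y i ≤ x i}`. [folklore] -/
theorem transOperator_single_eq_zero_of_ge
    {β : EuclideanSpace ℝ ι → EuclideanSpace ℝ ι [⋀^Fin (k + 1)]→L[ℝ] F} {x : EuclideanSpace ℝ ι}
    {i : ι} {c : ℝ} (hc : c ≤ 0) (h : ∀ y : EuclideanSpace ℝ ι, y i ≤ x i → β y = 0) :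
    transOperator (c • EuclideanSpace.single i (1 : ℝ)) β x = 0 := by
  refine transOperator_eq_zero_of_forall _ fun t ht ↦ h _ ?_
  rw [smul_smul, coord_add_smul_single_self]
  have : t * c ≤ 0 := mul_nonpos_of_nonneg_of_nonpos ht.1 hc
  linarith

omit [DecidableEq ι] in
/-- A form supported in the closed `r`-ball vanishes at points with a coordinate of modulus `> r`.
[folklore] -/
theorem eq_zero_of_lt_abs_coord {τ : EuclideanSpace ℝ ι → EuclideanSpace ℝ ι [⋀^Fin k]→L[ℝ] F}
    {r : ℝ} (hs : ∀ y, τ y ≠ 0 → ‖y‖ ≤ r) {y : EuclideanSpace ℝ ι} {j : ι} (hy : r < |y j|) :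
    τ y = 0 := by
  by_contra h
  exact absurd ((hs y h).trans_lt hy)
    (not_lt.2 (by simpa only [Real.norm_eq_abs] using PiLp.norm_apply_le y j))

/-- **A primitive on a slab.** For a closed `C^∞` form `τ` supported in the closed `r`-ball and
`|c| > |xᵢ| + r`, the shifted primitive `−P_{c eᵢ} τ` satisfies `d(−P_{c eᵢ} τ) x = τ x` (the error
term `τ (x + c eᵢ)` of `extDeriv_neg_transOperator` lies outside the support). [folklore] -/
theorem extDeriv_neg_transOperator_single [CompleteSpace F]
    {τ : EuclideanSpace ℝ ι → EuclideanSpace ℝ ι [⋀^Fin (k + 1)]→L[ℝ] F} {r : ℝ}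
    (hτ : ContDiff ℝ ∞ τ) (hd : extDeriv τ = 0) (hs : ∀ y, τ y ≠ 0 → ‖y‖ ≤ r) {c : ℝ} {i : ι}
    {x : EuclideanSpace ℝ ι} (hx : |x i| + r < |c|) :
    extDeriv (fun y ↦ -transOperator (c • EuclideanSpace.single i (1 : ℝ)) τ y) x = τ x := by
  rw [extDeriv_neg_transOperator _ hτ, hd, transOperator_zero, Pi.zero_apply, add_zero]
  have h0 : τ (x + c • EuclideanSpace.single i (1 : ℝ)) = 0 := by
    refine eq_zero_of_lt_abs_coord hs (j := i) ?_
    rw [coord_add_smul_single_self]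
    have h1 : |c| - |x i| ≤ |x i + c| := by
      have := abs_sub_abs_le_abs_sub c (-(x i))
      rwa [abs_neg, sub_neg_eq_add, add_comm] at this
    linarith
  rw [h0, sub_zero]

end Coordinates


/-! ## Fibre integration in finite pieces -/

section Fibre

variable {F : Type*} [NormedAddCommGroup F] [NormedSpace ℝ F] [CompleteSpace F] {k : ℕ} {r : ℝ}

/-- **Fibre-integration data** (Bott–Tu (1982), §I.4, made finite). For a closed `C^∞` form `τ` of
degree `2` on `ℝ⁴` supported in the closed `r`-ball, `r ≥ 0`, with `T = 3r + 4`: the primitives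
`β⁺ = −P_{T e₀} τ`, `β⁻ = −P_{−T e₀} τ` of `τ` on the slab `|x₀| < 2r + 4`, supported in the
half-cylinders `{x₀ ≤ r}` resp. `{x₀ ≥ −r}` over `{|x₁|, |x₂|, |x₃| ≤ r}`, and the primitive
`q⁺ = −P_{T e₁} (β⁻ − β⁺)` of the closed `1`-form `β⁻ − β⁺` on `{|x₀|, |x₁| < 2r + 4}`, which is
supported in `{|x₁|, |x₂|, |x₃| ≤ r}` there because it agrees with `q⁻ = −P_{−T e₁} (β⁻ − β⁺)`
(degree-`0` Poincaré lemma on a convex set, both vanishing at `(r + 1) e₂`).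
[cite: McDuffSalamon2017, §3.2] -/
theorem exists_fibre_data
    {τ : EuclideanSpace ℝ (Fin 4) → EuclideanSpace ℝ (Fin 4) [⋀^Fin 2]→L[ℝ] F}
    (hτ : ContDiff ℝ ∞ τ) (hd : extDeriv τ = 0) (hs : ∀ y, τ y ≠ 0 → ‖y‖ ≤ r) (hr : 0 ≤ r) :
    ∃ (βp βm : EuclideanSpace ℝ (Fin 4) → EuclideanSpace ℝ (Fin 4) [⋀^Fin 1]→L[ℝ] F)
      (qp : EuclideanSpace ℝ (Fin 4) → EuclideanSpace ℝ (Fin 4) [⋀^Fin 0]→L[ℝ] F),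
      ContDiff ℝ ∞ βp ∧ ContDiff ℝ ∞ βm ∧ ContDiff ℝ ∞ qp ∧
      (∀ x, |x 0| < 2 * r + 4 → extDeriv βp x = τ x) ∧
      (∀ x, r < x 0 → βp x = 0) ∧
      (∀ x, (∃ j, j ≠ 0 ∧ r < |x j|) → βp x = 0) ∧
      (∀ x, x 0 < -r → βm x = 0) ∧
      (∀ x, |x 0| < 2 * r + 4 → |x 1| < 2 * r + 4 → extDeriv qp x = βm x - βp x) ∧
      (∀ x, |x 0| < 2 * r + 4 → |x 1| < 2 * r + 4 → (∃ j, j ≠ 0 ∧ r < |x j|) → qp x = 0) := by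
  set T : ℝ := 3 * r + 4 with hT
  have hT0 : 0 ≤ T := by linarith
  have hTabs : |T| = T := abs_of_nonneg hT0
  have hTabs' : |(-T)| = T := by rw [abs_neg, hTabs]
  set e₀ : EuclideanSpace ℝ (Fin 4) := EuclideanSpace.single 0 (1 : ℝ) with he₀
  set e₁ : EuclideanSpace ℝ (Fin 4) := EuclideanSpace.single 1 (1 : ℝ) with he₁
  set βp : EuclideanSpace ℝ (Fin 4) → EuclideanSpace ℝ (Fin 4) [⋀^Fin 1]→L[ℝ] F :=
    fun y ↦ -transOperator (T • e₀) τ y with hβp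
  set βm : EuclideanSpace ℝ (Fin 4) → EuclideanSpace ℝ (Fin 4) [⋀^Fin 1]→L[ℝ] F :=
    fun y ↦ -transOperator ((-T) • e₀) τ y with hβm
  set Q : EuclideanSpace ℝ (Fin 4) → EuclideanSpace ℝ (Fin 4) [⋀^Fin 1]→L[ℝ] F :=
    fun y ↦ βm y - βp y with hQ
  have hβps : ContDiff ℝ ∞ βp := (contDiff_transOperator _ hτ).neg
  have hβms : ContDiff ℝ ∞ βm := (contDiff_transOperator _ hτ).neg
  have hQs : ContDiff ℝ ∞ Q := hβms.sub hβps
  -- stage 1: `β±` are primitives on the slab, with the stated supports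
  have hdp : ∀ x : EuclideanSpace ℝ (Fin 4), |x 0| < 2 * r + 4 → extDeriv βp x = τ x := fun x hx ↦
    extDeriv_neg_transOperator_single hτ hd hs (by rw [hTabs]; linarith)
  have hdm : ∀ x : EuclideanSpace ℝ (Fin 4), |x 0| < 2 * r + 4 → extDeriv βm x = τ x := fun x hx ↦
    extDeriv_neg_transOperator_single hτ hd hs (by rw [hTabs']; linarith)
  have hp1 : ∀ x : EuclideanSpace ℝ (Fin 4), r < x 0 → βp x = 0 := fun x hx ↦ by
    simp only [hβp]
    rw [transOperator_single_eq_zero_of_le hT0 fun y hy ↦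
      eq_zero_of_lt_abs_coord hs (j := 0) (by linarith [le_abs_self (y 0)]), neg_zero]
  have hp2 : ∀ x : EuclideanSpace ℝ (Fin 4), (∃ j, j ≠ 0 ∧ r < |x j|) → βp x = 0 :=
      fun x ⟨j, hj, hx⟩ ↦ by
    simp only [hβp]
    rw [transOperator_single_eq_zero_of_ne hj (fun y hy ↦
      eq_zero_of_lt_abs_coord hs (j := j) (by rw [hy]; exact hx)), neg_zero]
  have hm1 : ∀ x : EuclideanSpace ℝ (Fin 4), x 0 < -r → βm x = 0 := fun x hx ↦ by
    simp only [hβm]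
    rw [transOperator_single_eq_zero_of_ge (by linarith) fun y hy ↦
      eq_zero_of_lt_abs_coord hs (j := 0) (by linarith [neg_abs_le (y 0)]), neg_zero]
  have hm2 : ∀ x : EuclideanSpace ℝ (Fin 4), (∃ j, j ≠ 0 ∧ r < |x j|) → βm x = 0 :=
      fun x ⟨j, hj, hx⟩ ↦ by
    simp only [hβm]
    rw [transOperator_single_eq_zero_of_ne hj (fun y hy ↦
      eq_zero_of_lt_abs_coord hs (j := j) (by rw [hy]; exact hx)), neg_zero]
  have hQ0 : ∀ y : EuclideanSpace ℝ (Fin 4), (∃ j, j ≠ 0 ∧ r < |y j|) → Q y = 0 := fun y hy ↦ by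
    simp only [hQ, hm2 y hy, hp2 y hy, sub_zero]
  have hQd : ∀ y : EuclideanSpace ℝ (Fin 4), |y 0| < 2 * r + 4 → extDeriv Q y = 0 := fun y hy ↦ by
    simp only [hQ]
    rw [extDeriv_fun_sub (hβms.differentiable (by simp) y) (hβps.differentiable (by simp) y),
      hdm y hy, hdp y hy, sub_self]
  -- stage 2: `q± = -P_{±T e₁} Q` are primitives of `Q` on `{|x₀|, |x₁| < 2r + 4}` and agree
  have hdq : ∀ {c : ℝ}, |c| = T → ∀ x : EuclideanSpace ℝ (Fin 4),
      |x 0| < 2 * r + 4 → |x 1| < 2 * r + 4 →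
      extDeriv (fun y ↦ -transOperator (c • e₁) Q y) x = Q x := by
    intro c hc x hx0 hx1
    rw [extDeriv_neg_transOperator _ hQs, transOperator_single_eq_zero_of_ne (i := 1) (j := 0)
      zero_ne_one (fun y hy ↦ hQd y (by rw [hy]; exact hx0)), add_zero]
    have h0 : Q (x + c • e₁) = 0 := by
      refine hQ0 _ ⟨1, one_ne_zero, ?_⟩
      rw [he₁, coord_add_smul_single_self]
      have h1 : |c| - |x 1| ≤ |x 1 + c| := by
        have := abs_sub_abs_le_abs_sub c (-(x 1))
        rwa [abs_neg, sub_neg_eq_add, add_comm] at this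
      linarith
    rw [h0, sub_zero]
  set U : Set (EuclideanSpace ℝ (Fin 4)) := {y | |y 0| < 2 * r + 4 ∧ |y 1| < 2 * r + 4} with hU
  have hUo : IsOpen U := by
    have hco : ∀ i : Fin 4, Continuous fun y : EuclideanSpace ℝ (Fin 4) ↦ |y i| := fun i ↦
      (continuous_apply i).comp (PiLp.continuous_ofLp 2 _) |>.abs
    have h0 := hco 0
    have h1 := hco 1
    exact (isOpen_lt h0 continuous_const).inter (isOpen_lt h1 continuous_const)
  have hUc : Convex ℝ U := by
    have h : ∀ i : Fin 4, Convex ℝ {y : EuclideanSpace ℝ (Fin 4) | |y i| < 2 * r + 4} := fun i ↦ by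
      have : {y : EuclideanSpace ℝ (Fin 4) | |y i| < 2 * r + 4} =
          (EuclideanSpace.proj i : EuclideanSpace ℝ (Fin 4) →L[ℝ] ℝ) ⁻¹'
            Ioo (-(2 * r + 4)) (2 * r + 4) := by
        ext y; simp [abs_lt]
      rw [this]
      exact (convex_Ioo _ _).linear_preimage
        (EuclideanSpace.proj i : EuclideanSpace ℝ (Fin 4) →L[ℝ] ℝ).toLinearMap
    exact (h 0).inter (h 1)
  set p₀ : EuclideanSpace ℝ (Fin 4) := (r + 1) • EuclideanSpace.single 2 (1 : ℝ) with hp₀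
  have hp₀0 : p₀ 0 = 0 := by simp [hp₀]
  have hp₀1 : p₀ 1 = 0 := by simp [hp₀]
  have hp₀2 : p₀ 2 = r + 1 := by simp [hp₀]
  have hp₀U : p₀ ∈ U := by
    refine ⟨?_, ?_⟩
    · rw [hp₀0, abs_zero]; linarith
    · rw [hp₀1, abs_zero]; linarith
  have hq0 : ∀ {c : ℝ} (x : EuclideanSpace ℝ (Fin 4)), (∃ j, j ≠ 0 ∧ j ≠ 1 ∧ r < |x j|) →
      transOperator (c • e₁) Q x = 0 := fun {c} x ⟨j, hj0, hj1, hx⟩ ↦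
    transOperator_single_eq_zero_of_ne hj1 (fun y hy ↦ hQ0 y ⟨j, hj0, by rw [hy]; exact hx⟩) c
  have hqp₀ : ∀ c : ℝ, transOperator (c • e₁) Q p₀ = 0 := fun c ↦
    hq0 p₀ ⟨2, by decide, by decide, by rw [hp₀2, abs_of_nonneg (by linarith)]; linarith⟩
  have hqeq : ∀ x ∈ U, transOperator (T • e₁) Q x = transOperator ((-T) • e₁) Q x := by
    intro x hx
    have key := eq_of_extDeriv_eq_zero_of_starConvex hUo (hUc.starConvex hp₀U)
      (f := fun y ↦ -transOperator ((-T) • e₁) Q y - -transOperator (T • e₁) Q y)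
      (((contDiff_transOperator _ hQs).neg.sub (contDiff_transOperator _ hQs).neg).differentiable
        (by simp)).differentiableOn (fun y hy ↦ ?_) hx
    · simp only [hqp₀, neg_zero, sub_zero] at key
      rw [sub_eq_zero, neg_inj] at key
      exact key.symm
    · rw [extDeriv_fun_sub ((contDiff_transOperator _ hQs).neg.differentiable (by simp) y)
        ((contDiff_transOperator _ hQs).neg.differentiable (by simp) y),
        hdq hTabs' y hy.1 hy.2, hdq hTabs y hy.1 hy.2, sub_self]
  refine ⟨βp, βm, fun y ↦ -transOperator (T • e₁) Q y, hβps, hβms,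
    (contDiff_transOperator _ hQs).neg, hdp, hp1, hp2, hm1,
    fun x hx0 hx1 ↦ hdq hTabs x hx0 hx1, fun x hx0 hx1 ⟨j, hj, hxj⟩ ↦ ?_⟩
  rw [neg_eq_zero]
  by_cases hj1 : j = 1
  · subst hj1
    rcases lt_abs.1 hxj with h | h
    · exact transOperator_single_eq_zero_of_le hT0 fun y hy ↦
        hQ0 y ⟨1, one_ne_zero, by linarith [le_abs_self (y 1)]⟩
    · rw [hqeq x ⟨hx0, hx1⟩]
      exact transOperator_single_eq_zero_of_ge (by linarith) fun y hy ↦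
        hQ0 y ⟨1, one_ne_zero, by linarith [neg_abs_le (y 1)]⟩
  · exact hq0 x ⟨j, hj, hj1, hxj⟩

/-- **Registered helper sub-goal `helper_fibreData`** (the case `F = ℝ` of `exists_fibre_data`,
one-line form): fibre-integration data of a closed compactly supported `2`-form on `ℝ⁴`.
[cite: McDuffSalamon2017, §3.2] -/
theorem helper_fibreData : ∀ (r : ℝ)
    (τ : EuclideanSpace ℝ (Fin 4) → EuclideanSpace ℝ (Fin 4) [⋀^Fin 2]→L[ℝ] ℝ),
    ContDiff ℝ ∞ τ → extDeriv τ = 0 → (∀ y, τ y ≠ 0 → ‖y‖ ≤ r) → 0 ≤ r →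
    ∃ (βp βm : EuclideanSpace ℝ (Fin 4) → EuclideanSpace ℝ (Fin 4) [⋀^Fin 1]→L[ℝ] ℝ)
      (qp : EuclideanSpace ℝ (Fin 4) → EuclideanSpace ℝ (Fin 4) [⋀^Fin 0]→L[ℝ] ℝ),
      ContDiff ℝ ∞ βp ∧ ContDiff ℝ ∞ βm ∧ ContDiff ℝ ∞ qp ∧
      (∀ x, |x 0| < 2 * r + 4 → extDeriv βp x = τ x) ∧
      (∀ x, r < x 0 → βp x = 0) ∧
      (∀ x, (∃ j, j ≠ 0 ∧ r < |x j|) → βp x = 0) ∧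
      (∀ x, x 0 < -r → βm x = 0) ∧
      (∀ x, |x 0| < 2 * r + 4 → |x 1| < 2 * r + 4 → extDeriv qp x = βm x - βp x) ∧
      (∀ x, |x 0| < 2 * r + 4 → |x 1| < 2 * r + 4 → (∃ j, j ≠ 0 ∧ r < |x j|) → qp x = 0) :=
  fun _ _ hτ hd hs hr ↦ exists_fibre_data hτ hd hs hr

end Fibre

end Summit.SmoothPoincare4.SmoothPoincare4.Theorems.GromovRecognitionRelEnd.CrossCapLaurent

end
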